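import Mathlib

/-!
# Bilinear and cubic identities for pencil dependencies; over `𝔽₄` an antichain has even colour classes

Helper file for crux `stmt-CriticalPhenomena-4575` (`NoHeavyLowerTail`, route `PercNearOneGluingNoHeavy`), new-inequality factory
seat `prim-ineq-gen-3` (gen 30).  Everything here is PROVED; no definitions.  Mathlib only.

Notation (memo `run/shared/lean/prim/prim-ineq-gen-3/CONJECTURE-P2F2.md` §7–§8): a PENCIL DEPENDENCY of a finite family `𝒜` at
`t` is `c : 𝒜 → R` with `∑_A c_A ([E ⊆ A] + t [E ∩ A = ∅]) = 0` for every `E ∈ 𝒜 \\ 𝒜` (here `c` is any function on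
`Finset α`, summed over `A ∈ 𝒜`).  CONJECTURE CR(2) at `ω` says there is none with `c ≠ 0` over `𝔽₄` at `t = ω`.  The memo's
proof frame consists of the 'summed equations' `R_i = ∑_k c_k · eq(i,k)` and `C_k = ∑_i c_i · eq(i,k)`, in which — in
characteristic `2` — the symmetric `σ`-terms (resp. `τ`-terms) cancel in pairs, leaving identities about the trace posets at one
member (the five-line parity proof of Marica–Schönheim, `…AbstractMSParity`, is the case `t = 0`).  This file states and proves
them for honest families, for every commutative ring and every `t`, using that EVERY ordered pair `(B, C)` of members gives a
legitimate column `E = B \ C ∈ 𝒜 \\ 𝒜` (no 'unguarded form' is needed) and the symmetric rewriting of its entries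
`[B \ C ⊆ A] = [B ⊆ A ∪ C]`, `[(B \ C) ∩ A = ∅] = [A ∩ B ⊆ C]` (`pencilEntry_sdiff_eq`).

* `pencil_rowsum`, `pencil_colsum` — any commutative ring: `∑_{A,C} c_A c_C ([B ⊆ A ∪ C] + t [A ∩ B ⊆ C]) = 0` for each member
  `B` (columns `B \ C` weighted by `c_C`), and `∑_{A,B} c_A c_B (…) = 0` for each member `C` (weighted by `c_B`).
* `sum_sum_symm_eq_diag_of_charTwo` — in characteristic `2` a symmetric double sum collapses to its diagonal.
* `pencil_rowsum_charTwo` — ★ (`R_B`)  `∑_{A ⊇ B} c_A² + t ∑_{(A,C) : A ∩ B ⊆ C} c_A c_C = 0` at every member `B`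
  (inner traces `A ∩ B`).
* `pencil_colsum_charTwo` — ★ (`C_C`)  `∑_{(A,B) : B ⊆ A ∪ C} c_A c_B + t ∑_{A ⊆ C} c_A² = 0` at every member `C`
  (outer traces `A \ C`).
* `pencil_cubic_charTwo` — ★★ NEW global identity (`∑_B c_B R_B`; now the `τ`-terms cancel as well, by the symmetry of
  `[A ∩ B ⊆ C]` in `A, B`):  `∑_{(B,A) : B ⊆ A} (c_B c_A² + t c_B² c_A) = 0`, the sum over ordered pairs of NESTED members
  (diagonal included, contributing `(1 + t) ∑ c_A³`).
* `sum_cube_eq_zero_of_antichain` — ★ for an ANTICHAIN and `t ≠ 1` over a field of characteristic `2`: `∑_A c_A³ = 0`.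
* `even_card_support_of_antichain` — ★ if the non-zero values of `c` are cube roots of unity (automatic in `𝔽₄`), the support of
  `c` has even size; with the `∅`-column relation `∑ c_A = 0` (the three colour classes `{c = 1}, {c = ω}, {c = ω²}` have equal
  parity) every colour class of a bad `𝔽₄`-colouring of an antichain is EVEN — a bad colouring with odd classes needs a strict
  containment among its members (the SAT-hard 'antichain core' of memo §7 thus has even classes only).
(prim-ineq-gen-3 gen 30, 2026-08-26.)
-/

namespace Summit.CriticalPhenomena.PercolationContinuityZ3.Theorems

namespace OrderedDifferences

open Finset
open scoped FinsetFamily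

variable {α : Type*} [DecidableEq α]

/-- The pencil entry of the column `E = B \ C` at the row `A`, rewritten symmetrically:
`[B \ C ⊆ A] + t [(B \ C) ∩ A = ∅] = [B ⊆ A ∪ C] + t [A ∩ B ⊆ C]`. -/
theorem pencilEntry_sdiff_eq {R : Type*} [CommRing R] (t : R) (A B C : Finset α) :
    ((if B \ C ⊆ A then (1 : R) else 0) + t * (if Disjoint (B \ C) A then (1 : R) else 0)) =
      ((if B ⊆ A ∪ C then (1 : R) else 0) + t * (if A ∩ B ⊆ C then (1 : R) else 0)) := by
  have h1 : B \ C ⊆ A ↔ B ⊆ A ∪ C := by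
    constructor
    · intro h x hxB
      by_cases hxC : x ∈ C
      · exact mem_union.mpr (Or.inr hxC)
      · exact mem_union.mpr (Or.inl (h (mem_sdiff.mpr ⟨hxB, hxC⟩)))
    · intro h x hx
      rw [mem_sdiff] at hx
      rcases mem_union.mp (h hx.1) with hxA | hxC
      · exact hxA
      · exact absurd hxC hx.2
  have h2 : Disjoint (B \ C) A ↔ A ∩ B ⊆ C := by
    rw [disjoint_left]
    constructor
    · intro h x hx
      rw [mem_inter] at hx
      by_contra hxC
      exact h (mem_sdiff.mpr ⟨hx.2, hxC⟩) hx.1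
    · intro h x hxs hxA
      rw [mem_sdiff] at hxs
      exact hxs.2 (h (mem_inter.mpr ⟨hxA, hxs.1⟩))
  simp only [h1, h2]

/-- **Row-sum identity (any commutative ring).**  If `c` is a pencil dependency of `𝒜` at `t`
(`∑_A c_A ([E ⊆ A] + t [E ∩ A = ∅]) = 0` for every `E ∈ 𝒜 \\ 𝒜`), then for every member `B`:
`∑_{A, C ∈ 𝒜} c_A c_C ([B ⊆ A ∪ C] + t [A ∩ B ⊆ C]) = 0` (the columns `E = B \ C` weighted by `c_C`). -/
theorem pencil_rowsum (𝒜 : Finset (Finset α)) {R : Type*} [CommRing R] (t : R) (c : Finset α → R)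
    (hdep : ∀ E ∈ 𝒜 \\ 𝒜, ∑ A ∈ 𝒜, c A * ((if E ⊆ A then (1 : R) else 0) + t * (if Disjoint E A then (1 : R) else 0)) = 0)
    (B : Finset α) (hB : B ∈ 𝒜) :
    ∑ A ∈ 𝒜, ∑ C ∈ 𝒜, c A * c C * ((if B ⊆ A ∪ C then (1 : R) else 0) + t * (if A ∩ B ⊆ C then (1 : R) else 0)) = 0 := by
  rw [sum_comm]
  apply sum_eq_zero
  intro C hC
  have h := hdep (B \ C) (mem_diffs.mpr ⟨B, hB, C, hC, rfl⟩)
  have e : ∑ A ∈ 𝒜, c A * c C * ((if B ⊆ A ∪ C then (1 : R) else 0) + t * (if A ∩ B ⊆ C then (1 : R) else 0)) =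
      c C * ∑ A ∈ 𝒜, c A * ((if B \ C ⊆ A then (1 : R) else 0) + t * (if Disjoint (B \ C) A then (1 : R) else 0)) := by
    rw [mul_sum]
    refine sum_congr rfl fun A _ => ?_
    rw [pencilEntry_sdiff_eq t A B C]
    ring
  rw [e, h, mul_zero]

/-- **Column-sum identity (any commutative ring).**  Under the same hypothesis, for every member `C`:
`∑_{A, B ∈ 𝒜} c_A c_B ([B ⊆ A ∪ C] + t [A ∩ B ⊆ C]) = 0` (the columns `E = B \ C` weighted by `c_B`). -/
theorem pencil_colsum (𝒜 : Finset (Finset α)) {R : Type*} [CommRing R] (t : R) (c : Finset α → R)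
    (hdep : ∀ E ∈ 𝒜 \\ 𝒜, ∑ A ∈ 𝒜, c A * ((if E ⊆ A then (1 : R) else 0) + t * (if Disjoint E A then (1 : R) else 0)) = 0)
    (C : Finset α) (hC : C ∈ 𝒜) :
    ∑ A ∈ 𝒜, ∑ B ∈ 𝒜, c A * c B * ((if B ⊆ A ∪ C then (1 : R) else 0) + t * (if A ∩ B ⊆ C then (1 : R) else 0)) = 0 := by
  rw [sum_comm]
  apply sum_eq_zero
  intro B hB
  have h := hdep (B \ C) (mem_diffs.mpr ⟨B, hB, C, hC, rfl⟩)
  have e : ∑ A ∈ 𝒜, c A * c B * ((if B ⊆ A ∪ C then (1 : R) else 0) + t * (if A ∩ B ⊆ C then (1 : R) else 0)) =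
      c B * ∑ A ∈ 𝒜, c A * ((if B \ C ⊆ A then (1 : R) else 0) + t * (if Disjoint (B \ C) A then (1 : R) else 0)) := by
    rw [mul_sum]
    refine sum_congr rfl fun A _ => ?_
    rw [pencilEntry_sdiff_eq t A B C]
    ring
  rw [e, h, mul_zero]

/-- In characteristic `2`, a symmetric bilinear double sum collapses to its diagonal:
`∑_{a,b ∈ s} c_a c_b f(a,b) = ∑_{a ∈ s} c_a² f(a,a)` when `f(a,b) = f(b,a)`. -/
theorem sum_sum_symm_eq_diag_of_charTwo {ι R : Type*} [DecidableEq ι] [CommRing R] [CharP R 2] (s : Finset ι)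
    (g : ι → ι → R) (hg : ∀ a ∈ s, ∀ b ∈ s, g a b = g b a) :
    ∑ a ∈ s, ∑ b ∈ s, g a b = ∑ a ∈ s, g a a := by
  rw [← sum_product' (s := s) (t := s) (f := fun a b => g a b), ← diag_union_offDiag,
    sum_union (disjoint_diag_offDiag s), sum_diag]
  have hoff : ∑ p ∈ s.offDiag, g p.1 p.2 = 0 := by
    refine sum_involution (fun p _ => p.swap) ?_ ?_ ?_ ?_
    · intro p hp
      rw [mem_offDiag] at hp
      simp only [Prod.fst_swap, Prod.snd_swap]
      rw [hg p.2 hp.2.1 p.1 hp.1]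
      exact CharTwo.add_self_eq_zero _
    · intro p hp _
      rw [mem_offDiag] at hp
      intro heq
      exact hp.2.2 (by rw [Prod.ext_iff] at heq; simp only [Prod.fst_swap, Prod.snd_swap] at heq; exact heq.2)
    · intro p hp
      rw [mem_offDiag] at hp ⊢
      exact ⟨hp.2.1, hp.1, fun h => hp.2.2 h.symm⟩
    · intro p hp
      exact Prod.swap_swap p
  rw [hoff, add_zero]

/-- **Row-sum identity in characteristic `2`** (the `σ`-terms cancel in pairs).  For a pencil dependency `c` at `t` and every
member `B`:  `∑_{A ⊇ B} c_A² + t ∑_{A, C : A ∩ B ⊆ C} c_A c_C = 0`  — at a member `B` the INNER TRACES `A ∩ B` carry a weighted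
comparability count (memo CONJECTURE-P2F2 §7, identity `R_i`). -/
theorem pencil_rowsum_charTwo (𝒜 : Finset (Finset α)) {R : Type*} [CommRing R] [CharP R 2] (t : R) (c : Finset α → R)
    (hdep : ∀ E ∈ 𝒜 \\ 𝒜, ∑ A ∈ 𝒜, c A * ((if E ⊆ A then (1 : R) else 0) + t * (if Disjoint E A then (1 : R) else 0)) = 0)
    (B : Finset α) (hB : B ∈ 𝒜) :
    ∑ A ∈ 𝒜, (if B ⊆ A then c A * c A else 0) +
      t * ∑ A ∈ 𝒜, ∑ C ∈ 𝒜, (if A ∩ B ⊆ C then c A * c C else 0) = 0 := by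
  have h := pencil_rowsum 𝒜 t c hdep B hB
  have hsplit : ∑ A ∈ 𝒜, ∑ C ∈ 𝒜, c A * c C * ((if B ⊆ A ∪ C then (1 : R) else 0) + t * (if A ∩ B ⊆ C then (1 : R) else 0)) =
      ∑ A ∈ 𝒜, ∑ C ∈ 𝒜, (if B ⊆ A ∪ C then c A * c C else 0) +
        t * ∑ A ∈ 𝒜, ∑ C ∈ 𝒜, (if A ∩ B ⊆ C then c A * c C else 0) := by
    rw [mul_sum, ← sum_add_distrib]
    refine sum_congr rfl fun A _ => ?_
    rw [mul_sum, ← sum_add_distrib]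
    refine sum_congr rfl fun C _ => ?_
    split_ifs <;> ring
  rw [hsplit] at h
  have hsymm : ∑ A ∈ 𝒜, ∑ C ∈ 𝒜, (if B ⊆ A ∪ C then c A * c C else 0) = ∑ A ∈ 𝒜, (if B ⊆ A then c A * c A else 0) := by
    rw [sum_sum_symm_eq_diag_of_charTwo 𝒜 (fun A C => if B ⊆ A ∪ C then c A * c C else 0)
      (fun A _ C _ => by rw [union_comm, mul_comm])]
    refine sum_congr rfl fun A _ => ?_
    rw [union_idempotent]
  rw [hsymm] at h
  exact h

/-- **Column-sum identity in characteristic `2`** (the `τ`-terms cancel in pairs).  For a pencil dependency `c` at `t` and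
every member `C`:  `∑_{A, B : B ⊆ A ∪ C} c_A c_B + t ∑_{A ⊆ C} c_A² = 0`  — at a member `C` the OUTER TRACES `A \ C` carry a
weighted comparability count (memo §7, identity `C_k`). -/
theorem pencil_colsum_charTwo (𝒜 : Finset (Finset α)) {R : Type*} [CommRing R] [CharP R 2] (t : R) (c : Finset α → R)
    (hdep : ∀ E ∈ 𝒜 \\ 𝒜, ∑ A ∈ 𝒜, c A * ((if E ⊆ A then (1 : R) else 0) + t * (if Disjoint E A then (1 : R) else 0)) = 0)
    (C : Finset α) (hC : C ∈ 𝒜) :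
    ∑ A ∈ 𝒜, ∑ B ∈ 𝒜, (if B ⊆ A ∪ C then c A * c B else 0) +
      t * ∑ A ∈ 𝒜, (if A ⊆ C then c A * c A else 0) = 0 := by
  have h := pencil_colsum 𝒜 t c hdep C hC
  have hsplit : ∑ A ∈ 𝒜, ∑ B ∈ 𝒜, c A * c B * ((if B ⊆ A ∪ C then (1 : R) else 0) + t * (if A ∩ B ⊆ C then (1 : R) else 0)) =
      ∑ A ∈ 𝒜, ∑ B ∈ 𝒜, (if B ⊆ A ∪ C then c A * c B else 0) +
        t * ∑ A ∈ 𝒜, ∑ B ∈ 𝒜, (if A ∩ B ⊆ C then c A * c B else 0) := by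
    rw [mul_sum, ← sum_add_distrib]
    refine sum_congr rfl fun A _ => ?_
    rw [mul_sum, ← sum_add_distrib]
    refine sum_congr rfl fun B _ => ?_
    split_ifs <;> ring
  rw [hsplit] at h
  have hsymm : ∑ A ∈ 𝒜, ∑ B ∈ 𝒜, (if A ∩ B ⊆ C then c A * c B else 0) = ∑ A ∈ 𝒜, (if A ⊆ C then c A * c A else 0) := by
    rw [sum_sum_symm_eq_diag_of_charTwo 𝒜 (fun A B => if A ∩ B ⊆ C then c A * c B else 0)
      (fun A _ B _ => by rw [inter_comm, mul_comm])]
    refine sum_congr rfl fun A _ => ?_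
    rw [inter_self]
  rw [hsymm] at h
  exact h

/-- **The cubic identity in characteristic `2`** (`∑_B c_B R_B`: now the `τ`-terms cancel too, by the symmetry
`[A ∩ B ⊆ C] = [B ∩ A ⊆ C]`).  For a pencil dependency `c` at `t`:  `∑_{(B, A) : B ⊆ A} (c_B c_A² + t c_B² c_A) = 0`, the sum
over all ordered pairs of members with `B ⊆ A` (diagonal included). -/
theorem pencil_cubic_charTwo (𝒜 : Finset (Finset α)) {R : Type*} [CommRing R] [CharP R 2] (t : R) (c : Finset α → R)
    (hdep : ∀ E ∈ 𝒜 \\ 𝒜, ∑ A ∈ 𝒜, c A * ((if E ⊆ A then (1 : R) else 0) + t * (if Disjoint E A then (1 : R) else 0)) = 0) :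
    ∑ B ∈ 𝒜, ∑ A ∈ 𝒜, (if B ⊆ A then c B * (c A * c A) + t * (c B * c B * c A) else 0) = 0 := by
  -- ∑_B c_B · (row-sum identity at B)
  have hrow : ∀ B ∈ 𝒜, c B * (∑ A ∈ 𝒜, (if B ⊆ A then c A * c A else 0) +
      t * ∑ A ∈ 𝒜, ∑ C ∈ 𝒜, (if A ∩ B ⊆ C then c A * c C else 0)) = 0 := by
    intro B hB
    rw [pencil_rowsum_charTwo 𝒜 t c hdep B hB, mul_zero]
  have htot : ∑ B ∈ 𝒜, c B * (∑ A ∈ 𝒜, (if B ⊆ A then c A * c A else 0) +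
      t * ∑ A ∈ 𝒜, ∑ C ∈ 𝒜, (if A ∩ B ⊆ C then c A * c C else 0)) = 0 := sum_eq_zero hrow
  -- the triple sum is symmetric in (A, B): it collapses to its diagonal A = B
  have htriple : ∑ B ∈ 𝒜, c B * ∑ A ∈ 𝒜, ∑ C ∈ 𝒜, (if A ∩ B ⊆ C then c A * c C else 0) =
      ∑ A ∈ 𝒜, ∑ C ∈ 𝒜, (if A ⊆ C then c A * c A * c C else 0) := by
    have e1 : ∑ B ∈ 𝒜, c B * ∑ A ∈ 𝒜, ∑ C ∈ 𝒜, (if A ∩ B ⊆ C then c A * c C else 0) =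
        ∑ B ∈ 𝒜, ∑ A ∈ 𝒜, (∑ C ∈ 𝒜, (if A ∩ B ⊆ C then c B * (c A * c C) else 0)) := by
      refine sum_congr rfl fun B _ => ?_
      rw [mul_sum]
      refine sum_congr rfl fun A _ => ?_
      rw [mul_sum]
      refine sum_congr rfl fun C _ => ?_
      split_ifs <;> ring
    rw [e1, sum_sum_symm_eq_diag_of_charTwo 𝒜 (fun B A => ∑ C ∈ 𝒜, (if A ∩ B ⊆ C then c B * (c A * c C) else 0))
      (fun B _ A _ => by
        refine sum_congr rfl fun C _ => ?_
        rw [inter_comm]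
        split_ifs <;> ring)]
    refine sum_congr rfl fun A _ => ?_
    refine sum_congr rfl fun C _ => ?_
    rw [inter_self]
    split_ifs <;> ring
  have hsplit : ∑ B ∈ 𝒜, c B * (∑ A ∈ 𝒜, (if B ⊆ A then c A * c A else 0) +
      t * ∑ A ∈ 𝒜, ∑ C ∈ 𝒜, (if A ∩ B ⊆ C then c A * c C else 0)) =
      ∑ B ∈ 𝒜, ∑ A ∈ 𝒜, (if B ⊆ A then c B * (c A * c A) else 0) +
        t * ∑ B ∈ 𝒜, c B * ∑ A ∈ 𝒜, ∑ C ∈ 𝒜, (if A ∩ B ⊆ C then c A * c C else 0) := by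
    rw [mul_sum, ← sum_add_distrib]
    refine sum_congr rfl fun B _ => ?_
    rw [mul_add, mul_sum]
    congr 1
    · refine sum_congr rfl fun A _ => ?_
      split_ifs <;> ring
    · ring
  rw [hsplit, htriple] at htot
  -- combine the two double sums
  rw [show ∑ B ∈ 𝒜, ∑ A ∈ 𝒜, (if B ⊆ A then c B * (c A * c A) + t * (c B * c B * c A) else 0) =
      ∑ B ∈ 𝒜, ∑ A ∈ 𝒜, (if B ⊆ A then c B * (c A * c A) else 0) +
        t * ∑ A ∈ 𝒜, ∑ C ∈ 𝒜, (if A ⊆ C then c A * c A * c C else 0) from ?_]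
  · exact htot
  rw [mul_sum, ← sum_add_distrib]
  refine sum_congr rfl fun B _ => ?_
  rw [mul_sum, ← sum_add_distrib]
  refine sum_congr rfl fun A _ => ?_
  split_ifs <;> ring

/-- **Antichains: the cubes sum to zero.**  If `𝒜` is an antichain and `c` is a pencil dependency at `t ≠ 1` over a field of
characteristic `2`, then `∑_A c_A³ = 0` (the cubic identity has only diagonal terms, `(1 + t) ∑ c_A³`). -/
theorem sum_cube_eq_zero_of_antichain (𝒜 : Finset (Finset α)) (hanti : IsAntichain (· ⊆ ·) (𝒜 : Set (Finset α)))
    {F : Type*} [Field F] [CharP F 2] {t : F} (ht : t ≠ 1) (c : Finset α → F)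
    (hdep : ∀ E ∈ 𝒜 \\ 𝒜, ∑ A ∈ 𝒜, c A * ((if E ⊆ A then (1 : F) else 0) + t * (if Disjoint E A then (1 : F) else 0)) = 0) :
    ∑ A ∈ 𝒜, c A ^ 3 = 0 := by
  have h := pencil_cubic_charTwo 𝒜 t c hdep
  have hdiag : ∀ B ∈ 𝒜, ∑ A ∈ 𝒜, (if B ⊆ A then c B * (c A * c A) + t * (c B * c B * c A) else 0) = (1 + t) * c B ^ 3 := by
    intro B hB
    rw [sum_eq_single B]
    · rw [if_pos (subset_refl B)]
      ring
    · intro A hA hAB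
      rw [if_neg]
      intro hBA
      exact hAB (hanti.eq hB hA hBA).symm
    · intro hB'
      exact absurd hB hB'
  rw [sum_congr rfl hdiag, ← mul_sum] at h
  have h1t : (1 + t) ≠ 0 := by
    intro h0
    apply ht
    have : t = -1 := by linear_combination h0
    rw [this]
    -- in characteristic 2, -1 = 1
    have h2 : (2 : F) = 0 := by
      have := CharP.cast_eq_zero F 2
      simpa using this
    linear_combination -h2
  exact (mul_eq_zero.mp h).resolve_left h1t

/-- **Antichains over `𝔽₄`: the support of a bad colouring is even.**  If moreover every non-zero value of `c` is a cube
root of unity (`x³ = 1`, automatic in `𝔽₄`), then the number of members with `c_A ≠ 0` is even.  With the `∅`-column relation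
`∑ c_A = 0` (three colour classes of equal parity) this says: in a bad `𝔽₄`-colouring of an ANTICHAIN every colour class has
even size — a bad colouring with three odd classes needs a strict containment among members. -/
theorem even_card_support_of_antichain (𝒜 : Finset (Finset α)) (hanti : IsAntichain (· ⊆ ·) (𝒜 : Set (Finset α)))
    {F : Type*} [Field F] [CharP F 2] [DecidableEq F] {t : F} (ht : t ≠ 1) (c : Finset α → F)
    (hcube : ∀ A ∈ 𝒜, c A ≠ 0 → c A ^ 3 = 1)
    (hdep : ∀ E ∈ 𝒜 \\ 𝒜, ∑ A ∈ 𝒜, c A * ((if E ⊆ A then (1 : F) else 0) + t * (if Disjoint E A then (1 : F) else 0)) = 0) :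
    Even #(𝒜.filter fun A => c A ≠ 0) := by
  have h := sum_cube_eq_zero_of_antichain 𝒜 hanti ht c hdep
  have e : ∑ A ∈ 𝒜, c A ^ 3 = ∑ A ∈ 𝒜, (if c A ≠ 0 then (1 : F) else 0) := by
    refine sum_congr rfl fun A hA => ?_
    by_cases h0 : c A = 0
    · rw [h0, if_neg (not_not.mpr rfl)]
      ring
    · rw [if_pos h0, hcube A hA h0]
  rw [e, sum_boole] at h
  exact (CharP.cast_eq_zero_iff F 2 _).mp h |> even_iff_two_dvd.mpr

end OrderedDifferences

end Summit.CriticalPhenomena.PercolationContinuityZ3.Theorems
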